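import Literature.Geometry.Riemannian.ThreeShrinkerDegenerateLeaves
import Literature.Geometry.Riemannian.CovariantDerivChartBridge
import Literature.Geometry.Lorentzian.CoordCurvatureNormSq
import HarnessLib

/-!
# Degenerate three-dimensional shrinkers: parallel fields and the curvature along leaf geodesics

Continuation of `ThreeShrinkerDegenerateLeaves` (degenerate case of Munteanu–Wang 2016, Thm. 1.2:
`Ric ≥ 0`, `S > 0`, a null vector of `Ric`; locally `Ric = (S/2)(g − θ⊗θ)` with a parallel unit
null field `v`, `θ = g(v,·)`). This file supplies the two ingredients of the Jacobi-field analysis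
along the geodesics of the leaves `{v}^⊥`:

* `hasDerivAt_kappa_parallel`, `kappa_parallel_eq` — **`κ(W) = g(W,W) − (2/S)Ric(W,W)` is
  constant along every parallel field `W`** (`κ(W) = θ(W)²` in a chart, and `θ(W)` is constant
  since `v` and `W` are parallel; the chart form of parallel fields is
  `CovariantDerivChartBridge.hasDerivAt_chart_of_covariantDerivAlong_eq_zero`). In particular the
  parallel transport of a unit null vector stays null.
* `curvature_frame_of_null` — **the curvature endomorphism `R(·, u)u` in an orthonormal frame
  `(u, n, ν)` with `ν` null**: `g(R(n,u)u, n) = S/2` and the three entries involving `ν` vanish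
  (`R(·, ν) = 0`, pair symmetry, and `Ric(u,u) = Σ g(R(eᵢ,u)u, eᵢ)`), read through the chart
  (`val_riemann_source`).

Everything is proved; no definitions are introduced.

## References

* O. Munteanu, J. Wang, arXiv:1606.01861, Thm. 1.2 (p. 3). [MunteanuWang2016]
* P. Petersen, W. Wylie, Geom. Topol. 14 (2010), §3. [PetersenWylie2010]
* B. O'Neill, *Semi-Riemannian geometry*, 1983, Ch. 3, Lemma 3.20, Prop. 3.36, Lemma 3.52,
  Prop. 3.59. [ONeill1983]
-/

noncomputable section

set_option maxSynthPendingDepth 3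

open Bundle Set Function Filter Module Metric
open scoped Manifold ContDiff Topology NNReal

namespace Literature.Geometry.Riemannian

open Lorentzian Lorentzian.PseudoRiemannianMetric

variable {M : Type*} [TopologicalSpace M] [ChartedSpace (EuclideanSpace ℝ (Fin 3)) M]
  [IsManifold (𝓡 3) ∞ M]
  (g : PseudoRiemannianMetric (𝓡 3) ∞ (EuclideanSpace ℝ (Fin 3)) (TangentSpace (𝓡 3) : M → Type _))
  [g.HasLeviCivita]

namespace DegenerateShrinker

/-! ### The curvature tensor read in the chart -/

/-- `g(R(dΦ a, dΦ b) dΦ c, dΦ d) = G(riemAt G (a, b) c, d)` at `Φ u` (`riemann_comap_apply`,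
`OpensChart.riemann_eq_riemAt`). [cite: ONeill1983, Ch. 3, Prop. 3.59] -/
theorem val_riemann_chartInv (x₁ : M) (u : chartTarget (𝓡 3) x₁)
    (a b c d : EuclideanSpace ℝ (Fin 3)) :
    g.val (chartInv (𝓡 3) x₁ u)
        (g.riemann (chartInv (𝓡 3) x₁ u)
          (mfderiv 𝓘(ℝ, EuclideanSpace ℝ (Fin 3)) (𝓡 3) (chartInv (𝓡 3) x₁) u a)
          (mfderiv 𝓘(ℝ, EuclideanSpace ℝ (Fin 3)) (𝓡 3) (chartInv (𝓡 3) x₁) u b)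
          (mfderiv 𝓘(ℝ, EuclideanSpace ℝ (Fin 3)) (𝓡 3) (chartInv (𝓡 3) x₁) u c))
        (mfderiv 𝓘(ℝ, EuclideanSpace ℝ (Fin 3)) (𝓡 3) (chartInv (𝓡 3) x₁) u d) =
      chartRep (𝓡 3) (fun _ ↦ g) x₁ 0 u
        (MetricCoord.riemAt (chartRep (𝓡 3) (fun _ ↦ g) x₁ 0) u a b c) d := by
  haveI := (chartPullback (𝓡 3) g x₁).hasLeviCivita
  have hG := val_chartPullback_eq_chartRep (fun _ : ℝ ↦ g) x₁ 0
  have h1 : (chartPullback (𝓡 3) g x₁).riemann u a b c =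
      (mfderiv 𝓘(ℝ, EuclideanSpace ℝ (Fin 3)) (𝓡 3) (chartInv (𝓡 3) x₁) u).inverse
        (g.riemann (chartInv (𝓡 3) x₁ u)
          (mfderiv 𝓘(ℝ, EuclideanSpace ℝ (Fin 3)) (𝓡 3) (chartInv (𝓡 3) x₁) u a)
          (mfderiv 𝓘(ℝ, EuclideanSpace ℝ (Fin 3)) (𝓡 3) (chartInv (𝓡 3) x₁) u b)
          (mfderiv 𝓘(ℝ, EuclideanSpace ℝ (Fin 3)) (𝓡 3) (chartInv (𝓡 3) x₁) u c)) :=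
    g.riemann_comap_apply contMDiff_pullbackBilin_holds (contMDiff_chartInv x₁)
      (injective_mfderiv_chartInv x₁) rfl u a b c
  have h2 := Lorentzian.OpensChart.riemann_eq_riemAt hG u a b c
  have hinv : (mfderiv 𝓘(ℝ, EuclideanSpace ℝ (Fin 3)) (𝓡 3) (chartInv (𝓡 3) x₁) u).IsInvertible :=
    isInvertible_mfderiv_of_injective rfl (injective_mfderiv_chartInv x₁ u)
  have h3 : mfderiv 𝓘(ℝ, EuclideanSpace ℝ (Fin 3)) (𝓡 3) (chartInv (𝓡 3) x₁) u
      ((chartPullback (𝓡 3) g x₁).riemann u a b c) =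
      g.riemann (chartInv (𝓡 3) x₁ u)
        (mfderiv 𝓘(ℝ, EuclideanSpace ℝ (Fin 3)) (𝓡 3) (chartInv (𝓡 3) x₁) u a)
        (mfderiv 𝓘(ℝ, EuclideanSpace ℝ (Fin 3)) (𝓡 3) (chartInv (𝓡 3) x₁) u b)
        (mfderiv 𝓘(ℝ, EuclideanSpace ℝ (Fin 3)) (𝓡 3) (chartInv (𝓡 3) x₁) u c) := by
    rw [h1]; exact hinv.self_apply_inverse _
  rw [← h3, val_chartInv_mfderiv_eq_chartRep, h2]

/-- The curvature tensor in the chart direction: for `x` in the chart source and tangent vectors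
`a, b, c, d` at `x`, `g(R(a,b)c, d) = G(riemAt G (â, b̂) ĉ, d̂)` with hats `= dφ`.
[cite: ONeill1983, Ch. 3, Prop. 3.59] -/
theorem val_riemann_source (x₁ : M) {x : M} (hx : x ∈ (extChartAt (𝓡 3) x₁).source)
    (a b c d : TangentSpace (𝓡 3) x) :
    g.val x (g.riemann x a b c) d =
      chartRep (𝓡 3) (fun _ ↦ g) x₁ 0 (extChartAt (𝓡 3) x₁ x)
        (MetricCoord.riemAt (chartRep (𝓡 3) (fun _ ↦ g) x₁ 0) (extChartAt (𝓡 3) x₁ x)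
          (mfderiv (𝓡 3) (𝓡 3) (extChartAt (𝓡 3) x₁) x a)
          (mfderiv (𝓡 3) (𝓡 3) (extChartAt (𝓡 3) x₁) x b)
          (mfderiv (𝓡 3) (𝓡 3) (extChartAt (𝓡 3) x₁) x c))
        (mfderiv (𝓡 3) (𝓡 3) (extChartAt (𝓡 3) x₁) x d) := by
  set u : chartTarget (𝓡 3) x₁ := ⟨extChartAt (𝓡 3) x₁ x, (extChartAt (𝓡 3) x₁).map_source hx⟩
    with hu
  have h1 : chartInv (𝓡 3) x₁ u = x := (extChartAt (𝓡 3) x₁).left_inv hx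
  have ha := mfderiv_chartInv_mfderiv_extChartAt x₁ hx a
  have hb := mfderiv_chartInv_mfderiv_extChartAt x₁ hx b
  have hc := mfderiv_chartInv_mfderiv_extChartAt x₁ hx c
  have hd := mfderiv_chartInv_mfderiv_extChartAt x₁ hx d
  have key := val_riemann_chartInv g x₁ u (mfderiv (𝓡 3) (𝓡 3) (extChartAt (𝓡 3) x₁) x a)
    (mfderiv (𝓡 3) (𝓡 3) (extChartAt (𝓡 3) x₁) x b) (mfderiv (𝓡 3) (𝓡 3) (extChartAt (𝓡 3) x₁) x c)
    (mfderiv (𝓡 3) (𝓡 3) (extChartAt (𝓡 3) x₁) x d)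
  have ha' : mfderiv 𝓘(ℝ, EuclideanSpace ℝ (Fin 3)) (𝓡 3) (chartInv (𝓡 3) x₁) u
      (mfderiv (𝓡 3) (𝓡 3) (extChartAt (𝓡 3) x₁) x a) = a := ha
  have hb' : mfderiv 𝓘(ℝ, EuclideanSpace ℝ (Fin 3)) (𝓡 3) (chartInv (𝓡 3) x₁) u
      (mfderiv (𝓡 3) (𝓡 3) (extChartAt (𝓡 3) x₁) x b) = b := hb
  have hc' : mfderiv 𝓘(ℝ, EuclideanSpace ℝ (Fin 3)) (𝓡 3) (chartInv (𝓡 3) x₁) u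
      (mfderiv (𝓡 3) (𝓡 3) (extChartAt (𝓡 3) x₁) x c) = c := hc
  have hd' : mfderiv 𝓘(ℝ, EuclideanSpace ℝ (Fin 3)) (𝓡 3) (chartInv (𝓡 3) x₁) u
      (mfderiv (𝓡 3) (𝓡 3) (extChartAt (𝓡 3) x₁) x d) = d := hd
  rw [ha', hb', hc', hd'] at key
  rw [h1] at key
  exact key

section Along

variable [T2Space M] [ConnectedSpace M]
  -- `hg : g.IsRiemannian`, unfolded (positive definiteness on every tangent space)
  (hg : ∀ (x : M) (v : TangentSpace (𝓡 3) x), v ≠ 0 → 0 < g.val x v v)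
  {f : M → ℝ} (hf : ContMDiff (𝓡 3) 𝓘(ℝ, ℝ) ∞ f) {lam : ℝ}
  (hsol : ∀ (x : M) (X Y : TangentSpace (𝓡 3) x),
    g.ricci x X Y + g.hessian f x X Y = lam * g.val x X Y)
  (hRic0 : ∀ (x : M) (w : TangentSpace (𝓡 3) x), 0 ≤ g.ricci x w w)
  (hS : ∀ x, 0 < g.scalarCurvature x) {p₀ : M} {w₀ : TangentSpace (𝓡 3) p₀} (hw₀ : w₀ ≠ 0)
  (hnull : g.ricci p₀ w₀ w₀ = 0)
  {κ : (x : M) → TangentSpace (𝓡 3) x → ℝ}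
  (hκ : ∀ (x : M) (w : TangentSpace (𝓡 3) x),
    κ x w = g.val x w w - 2 / g.scalarCurvature x * g.ricci x w w)
include hg hf hsol hRic0 hS hw₀ hnull

/-! ### The curvature endomorphism in an orthonormal frame with a null member -/

omit [T2Space M] in
/-- **`R(·, u)u` in an orthonormal frame `(u, n, ν)` with `ν` null**: `g(R(n,u)u, n) = S/2`,
`g(R(ν,u)u, n) = g(R(n,u)u, ν) = g(R(ν,u)u, ν) = 0`. (In the chart: `νh = ±v`, `R(·, v) = 0`;
`g(R(n,u)u, ν) = g(R(u,ν)n, u) = 0` by pair symmetry; `Ric(u,u) = Σᵢ g(R(eᵢ,u)u, eᵢ)` over the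
frame gives `g(R(n,u)u,n) = Ric(u,u) = (S/2)(1 − θ(u)²) = S/2`.)
[cite: ONeill1983, Ch. 3, Prop. 3.36 and Lemma 3.52] [cite: PetersenWylie2010, §3] -/
theorem curvature_frame_of_null {x : M} {u n ν : TangentSpace (𝓡 3) x}
    (huu : g.val x u u = 1) (hnn : g.val x n n = 1) (hνν : g.val x ν ν = 1)
    (hun : g.val x u n = 0) (huν : g.val x u ν = 0) (hnν : g.val x n ν = 0)
    (hν : g.ricci x ν ν = 0) :
    g.val x (g.riemann x n u u) n = g.scalarCurvature x / 2 ∧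
    g.val x (g.riemann x ν u u) n = 0 ∧ g.val x (g.riemann x n u u) ν = 0 ∧
    g.val x (g.riemann x ν u u) ν = 0 := by
  obtain ⟨hGm, hGpos, -, -, hSpos, O, -, hu₀O, hOT, v, -, -, hunit, -, hRicO, hRiemO⟩ :=
    exists_chart_data g hg hf hsol hRic0 hS hw₀ hnull x
  have hxs : x ∈ (extChartAt (𝓡 3) x).source := mem_extChartAt_source x
  set G := chartRep (𝓡 3) (fun _ ↦ g) x 0 with hGdef
  set z := extChartAt (𝓡 3) x x with hz
  have hzT : z ∈ (extChartAt (𝓡 3) x).target := mem_extChartAt_target x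
  have hsy := hGm.symm z hzT
  set uh : EuclideanSpace ℝ (Fin 3) := mfderiv (𝓡 3) (𝓡 3) (extChartAt (𝓡 3) x) x u with huh
  set nh : EuclideanSpace ℝ (Fin 3) := mfderiv (𝓡 3) (𝓡 3) (extChartAt (𝓡 3) x) x n with hnh
  set νh : EuclideanSpace ℝ (Fin 3) := mfderiv (𝓡 3) (𝓡 3) (extChartAt (𝓡 3) x) x ν with hνh
  -- the dictionary
  have dv : ∀ a b : TangentSpace (𝓡 3) x, g.val x a b =
      G z (mfderiv (𝓡 3) (𝓡 3) (extChartAt (𝓡 3) x) x a)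
        (mfderiv (𝓡 3) (𝓡 3) (extChartAt (𝓡 3) x) x b) := fun a b ↦
    (dictionary_source g x hxs hf a b).1
  have dr : ∀ a b : TangentSpace (𝓡 3) x, g.ricci x a b =
      MetricCoord.ricAt G z (mfderiv (𝓡 3) (𝓡 3) (extChartAt (𝓡 3) x) x a)
        (mfderiv (𝓡 3) (𝓡 3) (extChartAt (𝓡 3) x) x b) := fun a b ↦
    (dictionary_source g x hxs hf a b).2.1
  have dS : g.scalarCurvature x = MetricCoord.scalAt G z := (dictionary_source g x hxs hf u u).2.2.1
  have guu : G z uh uh = 1 := by rw [← dv]; exact huu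
  have gnn : G z nh nh = 1 := by rw [← dv]; exact hnn
  have gνν : G z νh νh = 1 := by rw [← dv]; exact hνν
  have gun : G z uh nh = 0 := by rw [← dv]; exact hun
  have guν : G z uh νh = 0 := by rw [← dv]; exact huν
  have gnν : G z nh νh = 0 := by rw [← dv]; exact hnν
  -- `νh = θ v` with `θ² = 1`, hence `v = θ νh` and `R(·, νh) = 0`
  set θ := G z (v z) νh with hθ
  have hνnull : MetricCoord.ricAt G z νh νh = 0 := by rw [← dr]; exact hν
  have hνsq : G z νh νh = θ ^ 2 := by
    rw [hRicO z hu₀O] at hνnull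
    have h2 : MetricCoord.scalAt G z / 2 ≠ 0 := div_ne_zero (hSpos z hzT).ne' two_ne_zero
    have h3 := (mul_eq_zero.mp hνnull).resolve_left h2
    rw [hθ, sq]; linarith
  have hνv : νh = θ • v z := eq_smul_of_apply_self_eq_sq (hGpos z hzT) hsy (hunit z hu₀O) hνsq
  have hθ2 : θ ^ 2 = 1 := by rw [← hνsq, gνν]
  have hvν : v z = θ • νh := by
    rw [hνv, smul_smul, ← sq, hθ2, one_smul]
  have hRν : ∀ X, MetricCoord.riemAt G z X νh = 0 := fun X ↦ by
    rw [hνv, MetricCoord.riemAt_smul_right, hRiemO z hu₀O, smul_zero]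
  have hθu : G z (v z) uh = 0 := by
    rw [hvν, map_smul, FunLike.coe_smul, Pi.smul_apply, hsy νh uh, guν, smul_zero]
  -- the four entries in the chart
  have e2 : MetricCoord.riemAt G z νh uh uh = 0 := by
    rw [MetricCoord.riemAt_swap G z uh νh, hRν uh, neg_zero, _root_.zero_apply]
  have e3 : G z (MetricCoord.riemAt G z nh uh uh) νh = 0 := by
    rw [hGm.apply_riemAt_pair_comm hzT nh uh uh νh, hRν uh, _root_.zero_apply, map_zero,
      _root_.zero_apply]
  have e1 : G z (MetricCoord.riemAt G z nh uh uh) nh = MetricCoord.scalAt G z / 2 := by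
    -- the `G`-orthonormal basis `(uh, nh, νh)`
    have hon : ∀ i j : Fin 3, G z (![uh, nh, νh] i) (![uh, nh, νh] j) = if i = j then 1 else 0 := by
      intro i j
      fin_cases i <;> fin_cases j <;>
        simp [guu, gnn, gνν, gun, guν, gnν, hsy nh uh, hsy νh uh, hsy νh nh]
    have hli := linearIndependent_of_bilin_orthonormal (G z) hon
    have hcard : Fintype.card (Fin 3) = finrank ℝ (EuclideanSpace ℝ (Fin 3)) := by simp
    set e : Basis (Fin 3) ℝ (EuclideanSpace ℝ (Fin 3)) :=
      basisOfLinearIndependentOfCardEqFinrank hli hcard with he_def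
    have he : ⇑e = ![uh, nh, νh] := coe_basisOfLinearIndependentOfCardEqFinrank hli hcard
    have he' : ∀ i j, G z (e i) (e j) = if i = j then 1 else 0 := by
      intro i j; rw [he]; exact hon i j
    have hsum := MetricCoord.ricAt_eq_sum_of_orthonormal e he' uh uh
    rw [Fin.sum_univ_three, he] at hsum
    have h0 : (![uh, nh, νh] : Fin 3 → EuclideanSpace ℝ (Fin 3)) 0 = uh := rfl
    have h1 : (![uh, nh, νh] : Fin 3 → EuclideanSpace ℝ (Fin 3)) 1 = nh := rfl
    have h2 : (![uh, nh, νh] : Fin 3 → EuclideanSpace ℝ (Fin 3)) 2 = νh := rfl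
    rw [h0, h1, h2] at hsum
    -- `G(R(uh,uh)uh, uh) = 0` and `G(R(νh,uh)uh, νh) = 0`
    have hself : G z (MetricCoord.riemAt G z uh uh uh) uh = 0 := by
      have h := hGm.apply_riemAt_swap hzT uh uh uh uh
      linarith
    rw [hself, e2, map_zero, _root_.zero_apply, zero_add, add_zero, hRicO z hu₀O, guu, hθu] at hsum
    rw [← hsum]; ring
  -- back on the manifold
  refine ⟨?_, ?_, ?_, ?_⟩
  · rw [val_riemann_source g x hxs n u u n, dS]; exact e1
  · rw [val_riemann_source g x hxs ν u u n]
    change G z (MetricCoord.riemAt G z νh uh uh) nh = 0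
    rw [e2, map_zero, _root_.zero_apply]
  · rw [val_riemann_source g x hxs n u u ν]; exact e3
  · rw [val_riemann_source g x hxs ν u u ν]
    change G z (MetricCoord.riemAt G z νh uh uh) νh = 0
    rw [e2, map_zero, _root_.zero_apply]

omit [T2Space M] in
include hκ in
/-- **`κ(w) = g(ν, w)²` for a unit null vector `ν`** (`ν = ±v` in the chart, `κ = θ²`,
`θ = g(v, ·)`): in particular vectors orthogonal to `ν` are leaf vectors (`κ = 0`) and
`κ(ν) = 1`. [cite: PetersenWylie2010, §3] -/
theorem kappa_eq_sq_of_unit_null {x : M} {ν : TangentSpace (𝓡 3) x} (hνν : g.val x ν ν = 1)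
    (hν : g.ricci x ν ν = 0) (w : TangentSpace (𝓡 3) x) : κ x w = (g.val x ν w) ^ 2 := by
  obtain ⟨hGm, hGpos, -, -, hSpos, O, -, hu₀O, hOT, v, -, -, hunit, hnullO, hRicO, -⟩ :=
    exists_chart_data g hg hf hsol hRic0 hS hw₀ hnull x
  have hxs : x ∈ (extChartAt (𝓡 3) x).source := mem_extChartAt_source x
  set G := chartRep (𝓡 3) (fun _ ↦ g) x 0 with hGdef
  set z := extChartAt (𝓡 3) x x with hz
  have hzT : z ∈ (extChartAt (𝓡 3) x).target := mem_extChartAt_target x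
  have hsy := hGm.symm z hzT
  set νh : EuclideanSpace ℝ (Fin 3) := mfderiv (𝓡 3) (𝓡 3) (extChartAt (𝓡 3) x) x ν with hνh
  set wh : EuclideanSpace ℝ (Fin 3) := mfderiv (𝓡 3) (𝓡 3) (extChartAt (𝓡 3) x) x w with hwh
  obtain ⟨hκw, -⟩ := chart_reading g x hf hGm hGpos hunit hnullO hRicO hSpos hxs hu₀O w
  obtain ⟨dνν, dνr, -⟩ := dictionary_source g x hxs hf ν ν
  obtain ⟨dνw, -⟩ := dictionary_source g x hxs hf ν w
  set θ := G z (v z) νh with hθ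
  have hνnull : MetricCoord.ricAt G z νh νh = 0 := by rw [← dνr]; exact hν
  have hνsq : G z νh νh = θ ^ 2 := by
    rw [hRicO z hu₀O] at hνnull
    have h2 : MetricCoord.scalAt G z / 2 ≠ 0 := div_ne_zero (hSpos z hzT).ne' two_ne_zero
    have h3 := (mul_eq_zero.mp hνnull).resolve_left h2
    rw [hθ, sq]; linarith
  have hνv : νh = θ • v z := eq_smul_of_apply_self_eq_sq (hGpos z hzT) hsy (hunit z hu₀O) hνsq
  have hθ2 : θ ^ 2 = 1 := by rw [← hνsq, ← dνν]; exact hνν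
  have hvν : v z = θ • νh := by rw [hνv, smul_smul, ← sq, hθ2, one_smul]
  rw [hκ, hκw, dνw]
  change (G z (v z) wh) ^ 2 = (G z νh wh) ^ 2
  rw [hvν, map_smul, FunLike.coe_smul, Pi.smul_apply, smul_eq_mul, mul_pow, hθ2, one_mul]

/-! ### `κ` is constant along parallel fields -/

include hκ in
/-- **`κ(W)` has zero derivative along a parallel field `W`** over a geodesic: in a chart
`κ(W) = θ(wh)²` and `θ(wh)' = 0` (`v` parallel, `wh' = −Γ(U, wh)`).
[cite: ONeill1983, Ch. 3, Lemma 3.20] [cite: PetersenWylie2010, §3] -/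
theorem hasDerivAt_kappa_parallel {γ : ℝ → M} (hγ : IsGeodesicOn g.leviCivita γ univ)
    {W : Π t : ℝ, TangentSpace (𝓡 3) (γ t)} {s : Set ℝ}
    (hW : IsParallelAlongOn g.leviCivita γ W s) {t : ℝ} (ht : t ∈ s) :
    HasDerivAt (fun s ↦ κ (γ s) (W s)) 0 t := by
  obtain ⟨hGm, hGpos, -, -, hSpos, O, hOo, hu₀O, hOT, v, hvs, hpar, hunit, hnullO, hRicO, -⟩ :=
    exists_chart_data g hg hf hsol hRic0 hS hw₀ hnull (γ t)
  have hev := IsGeodesicOn.eventually_hasDerivAt_chart g (γ t) isOpen_univ hγ (mem_univ t)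
    (mem_extChartAt_source (γ t))
  obtain ⟨hsrc, hct, -⟩ := hev.self_of_nhds
  have hcO : ∀ᶠ s in 𝓝 t, extChartAt (𝓡 3) (γ t) (γ s) ∈ O :=
    hct.continuousAt.preimage_mem_nhds (hOo.mem_nhds hu₀O)
  have hP := hasDerivAt_chart_of_covariantDerivAlong_eq_zero g (γ t) hsrc (hW t ht).1 (hW t ht).2
  have hθ := (hGm.mono hOo hOT).hasDerivAt_theta_parallel hvs hpar
    (γ := fun s ↦ extChartAt (𝓡 3) (γ t) (γ s))
    (U := fun s ↦ mfderiv (𝓡 3) (𝓡 3) (extChartAt (𝓡 3) (γ t)) (γ s) (velocity (𝓡 3) γ s))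
    (s := t) hcO.self_of_nhds hct
    (W := fun s ↦ mfderiv (𝓡 3) (𝓡 3) (extChartAt (𝓡 3) (γ t)) (γ s) (W s)) hP
  have hθ2 : HasDerivAt (fun s ↦ (chartRep (𝓡 3) (fun _ ↦ g) (γ t) 0 (extChartAt (𝓡 3) (γ t) (γ s))
      (v (extChartAt (𝓡 3) (γ t) (γ s)))
      (mfderiv (𝓡 3) (𝓡 3) (extChartAt (𝓡 3) (γ t)) (γ s) (W s))) ^ 2)
      ((2 : ℕ) * (chartRep (𝓡 3) (fun _ ↦ g) (γ t) 0 (extChartAt (𝓡 3) (γ t) (γ t))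
        (v (extChartAt (𝓡 3) (γ t) (γ t)))
        (mfderiv (𝓡 3) (𝓡 3) (extChartAt (𝓡 3) (γ t)) (γ t) (W t))) ^ (2 - 1) * 0) t := hθ.pow 2
  rw [mul_zero] at hθ2
  refine hθ2.congr_of_eventuallyEq ?_
  filter_upwards [hev, hcO] with s hs hsO
  obtain ⟨h1, -⟩ := chart_reading g (γ t) hf hGm hGpos hunit hnullO hRicO hSpos hs.1 hsO (W s)
  rw [hκ, h1]

include hκ in
/-- **`κ(W)` is constant along a parallel field on an open interval.** In particular the
parallel transport of a unit null vector of `Ric` along a geodesic stays null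
(`Ric(W,W) = (S/2)(g(W,W) − κ(W))`). [cite: ONeill1983, Ch. 3, Lemma 3.20] -/
theorem kappa_parallel_eq {γ : ℝ → M} (hγ : IsGeodesicOn g.leviCivita γ univ)
    {W : Π t : ℝ, TangentSpace (𝓡 3) (γ t)} {a b : ℝ}
    (hW : IsParallelAlongOn g.leviCivita γ W (Ioo a b)) {t t' : ℝ} (ht : t ∈ Ioo a b)
    (ht' : t' ∈ Ioo a b) : κ (γ t) (W t) = κ (γ t') (W t') := by
  have hd := fun s (hs : s ∈ Ioo a b) ↦
    hasDerivAt_kappa_parallel g hg hf hsol hRic0 hS hw₀ hnull hκ hγ hW hs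
  exact isOpen_Ioo.is_const_of_deriv_eq_zero (convex_Ioo a b).isPreconnected
    (fun s hs ↦ (hd s hs).differentiableAt.differentiableWithinAt) (fun s hs ↦ (hd s hs).deriv)
    ht ht'

end Along

end DegenerateShrinker

end Literature.Geometry.Riemannian

end
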